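import Literature.Barriers.BirchSwinnertonDyer.RankNotSumOfLocalInvariantsCubicTwists
import Literature.NumberTheory.EllipticCurves.MordellCurveSqrtThreeDescentCount
import Literature.NumberTheory.EllipticCurves.MordellCurveCubicDescentLocal
import Literature.NumberTheory.NumberFields.EisensteinFieldSelmer
import HarnessLib

/-!
# The `√−3`-descent on `y² = x³ + (2^a 5^b)²` over `ℚ(ζ₃)`: the common machinery

Topic `Barriers/BirchSwinnertonDyer`. For the nine cubic twists `E_t : y² = x³ + t²`, `t = 2^a 5^b`
(`RankNotSumOfLocalInvariantsCubicTwists.lean`, the K-uniform witness family for `n = 3` of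
Dokchitser–Dokchitser 2011, Thm. 2), the Mordell–Weil ranks over `ℚ` are computed by the descent
via the `3`-isogeny `φ` with kernel `{O, (0, ±t)}` — over `K = ℚ(ζ₃)` the endomorphism `√−3` —
(Silverman *AEC* X.4, Exercise 10.9; Cassels 1964): `#δ(E_t(K)) = 3^{rank E_t(ℚ) + 1}` for the
descent map `δ(X, Y) = Y + t ∈ Kˣ/Kˣ³`
(`Literature/NumberTheory/EllipticCurves/MordellCurveSqrtThreeDescentCount.lean`), and `δ(E_t(K))`
is confined by local conditions. This file assembles, for general `t = 2^a 5^b`: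

* `CubicTwist.WK t` — `E_t` over `K3` written `Y² = X³ + (9c)²`, `c = t/9` (the shape of the tree's
  descent files), `δ = cubicDescent`;
* `exists_normalForm_delta` — `δ(P) = s ζ^i 2^k 5^l w³`, `s = ±1`, `i, k, l < 3`: cube valuations away
  from `30` (`three_dvd_log_cubicDescent_of_dvd`), the normal form of `K(S, 3)`
  (`EisensteinFieldSelmer.lean`), and no `λ = ζ − 1` (`λ ∤ 2t`);
* the local conditions as constraints on `(i, k, l)`: `l = 0` if `5 ∤ t`; `i = 0` if `4 ∤ t` (the
  cubic residue character `χ₂` of the `2`-unit part, a level-one residue character, vanishes on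
  `δ`: `MordellDescent.IsResidueChar.apply_cubicDescent_eq_zero`); `k = 0` if `4 ∣ t`
  (`3 ∣ ord₂ δ`); `i = 0` if `5 ∣ t` (`χ₅`); `2k + l ≡ 0` if `t ≡ 5 (mod 9)` (the level-three digit
  character `μ` at `λ`, `MordellDescent.IsDigitChar.apply_cubicDescent_eq_zero`, finite check
  `EisensteinFieldLambda.mu_eq_zero_of_units`);
* counting: `rank E_t(ℚ) + 1 ≤ s` when `δ(E_t(K3))` lies in the image of a set of size `≤ 3^s`
  (`rank_add_one_le_of_range_subset`), and `1 ≤ rank E_t(ℚ)` when `δ(E_t(K3))` has four distinct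
  elements (`one_le_rank_of_four`); the classes of `δ(O), δ(±T'), δ(P)` for integral points and the
  non-cube criterion for rationals (`cubeClass_ratCast_ne`, `p`-adic valuations).

## References

* J. H. Silverman, *The Arithmetic of Elliptic Curves*, 2nd ed., GTM 106 (2009), X.4 (descent via
  isogeny), Prop. X.4.9, Exercise 10.9, Remark X.4.7. [SilvermanAEC2009]
* J. W. S. Cassels, *Arithmetic on curves of genus 1. VI*, J. reine angew. Math. 214/215 (1964),
  p. 65. [Cassels1964ArithmeticVI]
* T. Dokchitser, V. Dokchitser, *A note on the Mordell–Weil rank modulo `n`*, J. Number Theory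
  131 (2011) 1833–1839, Thm. 2. [DokchitserDokchitser2011RankModN]
-/

noncomputable section

open scoped Classical WithZero

namespace Literature.Barriers.BirchSwinnertonDyer

namespace CubicTwist

open WeierstrassCurve Literature.NumberTheory.EllipticCurves Literature.NumberTheory.EllipticCurves.MordellDescent
  Literature.NumberTheory.NumberFields Literature.NumberTheory.NumberFields.K3
  IsDedekindDomain IsDedekindDomain.HeightOneSpectrum NumberField
open WithZero (log exp)

/-! ### The curves `E_t` over `K3` -/

/-- `c = t/9 ∈ K3`. [folklore] -/
def cK (t : ℕ) : K3 := (t : K3) / 9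

/-- **`E_t` over `K3`**: `Y² = X³ + (9c)²`, `9c = t`. [folklore] -/
abbrev WK (t : ℕ) : WeierstrassCurve K3 := mordellCurve ((9 * cK t) ^ 2)

/-- `9c = t`. [folklore] -/
@[simp] theorem nine_mul_cK (t : ℕ) : 9 * cK t = (t : K3) := by
  rw [cK]; field_simp

/-- `9c ≠ 0` for `t ≠ 0`. [folklore] -/
theorem nine_mul_cK_ne_zero {t : ℕ} (ht : t ≠ 0) : 9 * cK t ≠ 0 := by
  rw [nine_mul_cK]; exact_mod_cast ht

/-- `2^a 5^b ≠ 0`. [folklore] -/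
theorem tpow_ne_zero (a b : ℕ) : 2 ^ a * 5 ^ b ≠ 0 := by positivity

/-- `E_t/K3` is elliptic (`t ≠ 0`). [folklore] -/
instance instIsEllipticWK (a b : ℕ) : (WK (2 ^ a * 5 ^ b)).IsElliptic :=
  isElliptic_mordellCurve (pow_ne_zero 2 (nine_mul_cK_ne_zero (tpow_ne_zero a b)))

/-- **The descent map** `δ(P)` (`= Y + t`) on `E_t(K3)`. [cite: Cassels1964ArithmeticVI, p. 65] -/
abbrev delta (t : ℕ) (P : (WK t).toAffine.Point) : K3 := cubicDescent (WK t) (9 * cK t) P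

/-- **The descent class** `[δ(P)] ∈ K3ˣ/K3ˣ³`. [cite: Cassels1964ArithmeticVI, p. 65] -/
abbrev deltaClass (t : ℕ) (P : (WK t).toAffine.Point) : CubeUnits K3 :=
  cubicDescentClass (WK t) (9 * cK t) P

/-- `δ(P) ≠ 0`. [folklore] -/
theorem delta_ne_zero {t : ℕ} (ht : t ≠ 0) (P : (WK t).toAffine.Point) : delta t P ≠ 0 :=
  cubicDescent_ne_zero (mul_ne_zero two_ne_zero (nine_mul_cK_ne_zero ht)) P

/-! ### Cube valuations away from `30`, the normal form, no `λ` -/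

/-- **`3 ∣ ord_v δ(P)` at every finite place `v ∌ 30`** (`v(2t) = 1` there).
[cite: SilvermanAEC2009, Prop. X.4.9] -/
theorem three_dvd_log_delta (a b : ℕ) (P : (WK (2 ^ a * 5 ^ b)).toAffine.Point)
    (v : HeightOneSpectrum (𝓞 K3)) (hv : (30 : 𝓞 K3) ∉ v.asIdeal) :
    (3 : ℤ) ∣ log (v.valuation K3 (delta (2 ^ a * 5 ^ b) P)) := by
  refine (v.valuation K3).three_dvd_log_cubicDescent_of_dvd (W := WK _) rfl
    (nine_mul_cK_ne_zero (tpow_ne_zero a b)) two_ne_zero ?_ P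
  rw [nine_mul_cK, show ((2 ^ a * 5 ^ b : ℕ) : K3) = ((2 ^ a * 5 ^ b : ℕ) : K3) from rfl,
    log_valuation_two_mul_eq_zero hv a b]
  exact dvd_zero 3

/-- `3 ∣ ord_λ δ(P)` (`λ ∤ 2t`). [cite: SilvermanAEC2009, Prop. X.4.9] -/
theorem three_dvd_log_vL_delta (a b : ℕ) (P : (WK (2 ^ a * 5 ^ b)).toAffine.Point) :
    (3 : ℤ) ∣ log (vL (delta (2 ^ a * 5 ^ b) P)) := by
  refine vL.three_dvd_log_cubicDescent_of_dvd (W := WK _) rfl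
    (nine_mul_cK_ne_zero (tpow_ne_zero a b)) two_ne_zero ?_ P
  rw [nine_mul_cK, show (2 : K3) * ((2 ^ a * 5 ^ b : ℕ) : K3) = ((2 * (2 ^ a * 5 ^ b) : ℕ) : K3) by push_cast; ring,
    log_val_lam_natCast (by
      intro h3
      have h32 : ¬ (3 ∣ 2 ^ (a + 1)) := fun h ↦ by
        have := (Nat.Prime.dvd_of_dvd_pow Nat.prime_three h); omega
      have h35 : ¬ (3 ∣ 5 ^ b) := fun h ↦ by
        have := (Nat.Prime.dvd_of_dvd_pow Nat.prime_three h); omega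
      rw [show 2 * (2 ^ a * 5 ^ b) = 2 ^ (a + 1) * 5 ^ b by ring] at h3
      exact (Nat.prime_three.dvd_mul.mp h3).elim h32 h35)]
  exact dvd_zero 3

/-- **The normal form of `δ(P)`**: `δ(P) = s ζ^i 2^k 5^l w³` with `s = ±1`, `i, k, l < 3`,
`w ≠ 0` (no factor `λ`: `3 ∣ ord_λ δ`). [cite: SilvermanAEC2009, Prop. X.4.9] -/
theorem exists_normalForm_delta (a b : ℕ) (P : (WK (2 ^ a * 5 ^ b)).toAffine.Point) :
    ∃ (s : ℤ) (i k l : ℕ) (w : K3), (s = 1 ∨ s = -1) ∧ i < 3 ∧ k < 3 ∧ l < 3 ∧ w ≠ 0 ∧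
      delta (2 ^ a * 5 ^ b) P = s * zeta ^ i * 2 ^ k * 5 ^ l * w ^ 3 := by
  obtain ⟨s, i, j, k, l, w, hs, hi, hj, hk, hl, hw, h⟩ :=
    exists_normal_form (delta_ne_zero (tpow_ne_zero a b) P) (three_dvd_log_delta a b P)
  have hj0 : j = 0 := by
    refine j_eq_zero_of_dvd hs i j k l hw hj ?_
    rw [← h]; exact three_dvd_log_vL_delta a b P
  refine ⟨s, i, k, l, w, hs, hi, hk, hl, hw, ?_⟩
  rw [h, hj0, pow_zero, mul_one]

/-- From the `5`-parameter normal form back to the `6`-parameter one (`j = 0`). [folklore] -/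
theorem normalForm_six {d : K3} {s : ℤ} {i k l : ℕ} {w : K3}
    (h : d = s * zeta ^ i * 2 ^ k * 5 ^ l * w ^ 3) :
    d = s * zeta ^ i * (zeta - 1) ^ 0 * 2 ^ k * 5 ^ l * w ^ 3 := by
  rw [h, pow_zero, mul_one]

/-- `i < 3` with `(i : ℤ/3) = 0` forces `i = 0`. [folklore] -/
theorem eq_zero_of_cast_zmod_three {i : ℕ} (hi : i < 3) (h : (i : ZMod 3) = 0) : i = 0 := by
  interval_cases i
  · rfl
  · exact absurd h (by decide)
  · exact absurd h (by decide)

/-- `k, l < 3` with `2k + l ≡ 0 (mod 3)` forces `l = k`. [folklore] -/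
theorem l_eq_k_of_two_k_add_l {k l : ℕ} (hk : k < 3) (hl : l < 3) (h : (2 * k + l : ZMod 3) = 0) :
    l = k := by
  interval_cases k <;> interval_cases l <;> first | rfl | exact absurd h (by decide)

/-- **The class of `δ(P)` from its normal form**: `[δ(P)] = [ζ^i 2^k 5^l]`. [folklore] -/
theorem deltaClass_eq_of_normalForm {t : ℕ} {P : (WK t).toAffine.Point} {s : ℤ} {i k l : ℕ} {w : K3}
    (hs : s = 1 ∨ s = -1) (hw : w ≠ 0) (hd : delta t P = s * zeta ^ i * 2 ^ k * 5 ^ l * w ^ 3) :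
    deltaClass t P = cubeClass (zeta ^ i * 2 ^ k * 5 ^ l : K3) := by
  have h := cubeClass_normalForm hs i 0 k l hw
  rw [pow_zero, mul_one, mul_one] at h
  rw [deltaClass, cubicDescentClass, ← delta, hd, h]

/-! ### The residue and digit characters as instances of the abstract structures -/

/-- `χ₂` is a level-one residue character for `val₂`. [folklore] -/
theorem isResidueChar_chi2 : IsResidueChar (val prime_natCast_two) chi2 :=
  ⟨fun hx hy ↦ chi_mul _ cubicChar_mul_two hx hy, fun h ↦ chi_eq_of_val_sub_lt _ h,
    chi_neg_one _ cubicChar_ratCast_two⟩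

/-- `χ₅` is a level-one residue character for `val₅`. [folklore] -/
theorem isResidueChar_chi5 : IsResidueChar (val prime_natCast_five) chi5 :=
  ⟨fun hx hy ↦ chi_mul _ cubicChar_mul_five hx hy, fun h ↦ chi_eq_of_val_sub_lt _ h,
    chi_neg_one _ cubicChar_ratCast_five⟩

/-- `μ` is a level-three digit character for `vL`. [folklore] -/
theorem isDigitChar_mu : IsDigitChar vL mu :=
  ⟨fun hx hy ↦ mu_mul hx hy, fun hx h ↦ mu_eq_of_vL_sub_le hx h, mu_neg_one⟩

/-! ### Valuations of `t` and `2t` -/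

/-- `log val₂ (2^a 5^b) = −a`. [folklore] -/
theorem log_val2_t (a b : ℕ) : log (val prime_natCast_two ((2 ^ a * 5 ^ b : ℕ) : K3)) = -a := by
  push_cast
  rw [Valuation.log_map_mul _ (pow_ne_zero _ two_ne_zero) (pow_ne_zero _ (by norm_num)),
    Valuation.log_map_pow, Valuation.log_map_pow,
    show (2 : K3) = ((2 : ℕ) : K3) by norm_num, log_val_natCast_self,
    show (5 : K3) = ((5 : ℕ) : K3) by norm_num, log_val_natCast_of_not_dvd _ (by norm_num)]
  ring

/-- `log val₂ (2 · 2^a 5^b) = −(a + 1)`. [folklore] -/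
theorem log_val2_2t (a b : ℕ) : log (val prime_natCast_two (2 * ((2 ^ a * 5 ^ b : ℕ) : K3))) = -(a + 1) := by
  rw [Valuation.log_map_mul _ two_ne_zero (by exact_mod_cast tpow_ne_zero a b), log_val2_t,
    show (2 : K3) = ((2 : ℕ) : K3) by norm_num, log_val_natCast_self]
  ring

/-- `log val₅ (2^a 5^b) = −b`. [folklore] -/
theorem log_val5_t (a b : ℕ) : log (val prime_natCast_five ((2 ^ a * 5 ^ b : ℕ) : K3)) = -b := by
  push_cast
  rw [Valuation.log_map_mul _ (pow_ne_zero _ two_ne_zero) (pow_ne_zero _ (by norm_num)),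
    Valuation.log_map_pow, Valuation.log_map_pow,
    show (2 : K3) = ((2 : ℕ) : K3) by norm_num, log_val_natCast_of_not_dvd _ (by norm_num),
    show (5 : K3) = ((5 : ℕ) : K3) by norm_num, log_val_natCast_self]
  ring

/-- `log val₅ (2 · 2^a 5^b) = −b`. [folklore] -/
theorem log_val5_2t (a b : ℕ) : log (val prime_natCast_five (2 * ((2 ^ a * 5 ^ b : ℕ) : K3))) = -b := by
  rw [Valuation.log_map_mul _ two_ne_zero (by exact_mod_cast tpow_ne_zero a b), log_val5_t,
    show (2 : K3) = ((2 : ℕ) : K3) by norm_num, log_val_natCast_of_not_dvd _ (by norm_num)]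
  ring

/-! ### The local conditions as constraints on the normal form -/

section Conditions

variable {a b : ℕ} {P : (WK (2 ^ a * 5 ^ b)).toAffine.Point} {s : ℤ} {i k l : ℕ} {w : K3}
  (hs : s = 1 ∨ s = -1) (hi : i < 3) (hk : k < 3) (hl : l < 3) (hw : w ≠ 0)
  (hd : delta (2 ^ a * 5 ^ b) P = s * zeta ^ i * 2 ^ k * 5 ^ l * w ^ 3)
include hs hw hd

/-- **`5 ∤ t` ⟹ `l = 0`** (`3 ∣ ord₅ δ`). [cite: SilvermanAEC2009, Prop. X.4.9] -/
theorem l_eq_zero (hl : l < 3) (hb : b = 0) : l = 0 := by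
  subst hb
  refine l_eq_zero_of_dvd hs i 0 k l hw hl ?_
  rw [← normalForm_six hd]
  refine (val prime_natCast_five).three_dvd_log_cubicDescent_of_dvd (W := WK _) rfl
    (nine_mul_cK_ne_zero (tpow_ne_zero a 0)) two_ne_zero ?_ P
  rw [nine_mul_cK, log_val5_2t]; simp

/-- **`4 ∤ t` ⟹ `i = 0`**: `χ₂(δ) = 0` by the level-one residue character argument at `2` (window
`[−a − 1, −a]`, `a ≤ 1`), and `χ₂` of the normal form is `i`. [cite: SilvermanAEC2009, Exercise 10.9] -/
theorem i_eq_zero_of_le_one (hi : i < 3) (ha : a ≤ 1) : i = 0 := by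
  have h0 : chi2 (delta (2 ^ a * 5 ^ b) P) = 0 := by
    refine isResidueChar_chi2.apply_cubicDescent_eq_zero (W := WK _) rfl
      (nine_mul_cK_ne_zero (tpow_ne_zero a b)) two_ne_zero ?_ ?_ ?_ P
    · rw [nine_mul_cK]; exact chi_natCast _ cubicChar_ratCast_two _
    · rw [nine_mul_cK, show (2 : K3) * ((2 ^ a * 5 ^ b : ℕ) : K3) = ((2 * (2 ^ a * 5 ^ b) : ℕ) : K3) by
        push_cast; ring]
      exact chi_natCast _ cubicChar_ratCast_two _
    · intro n h1 h2 h3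
      rw [nine_mul_cK, log_val2_2t] at h1
      rw [nine_mul_cK, log_val2_t] at h2 ⊢
      refine ⟨by omega, ?_⟩
      rw [Valuation.lt_iff_log_lt _ (mul_ne_zero two_ne_zero (by exact_mod_cast tpow_ne_zero a b))
        (by exact_mod_cast tpow_ne_zero a b), log_val2_2t, log_val2_t]
      omega
  rw [hd, chi2_normalForm hs i k l hw] at h0
  exact eq_zero_of_cast_zmod_three hi h0

/-- **`4 ∣ t` (`a = 2`) ⟹ `k = 0`**: `3 ∣ ord₂(2t) = −3`, so `3 ∣ ord₂ δ`.
[cite: SilvermanAEC2009, Exercise 10.9] -/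
theorem k_eq_zero_of_eq_two (hk : k < 3) (ha : a = 2) : k = 0 := by
  subst ha
  refine k_eq_zero_of_dvd hs i 0 k l hw hk ?_
  rw [← normalForm_six hd]
  refine (val prime_natCast_two).three_dvd_log_cubicDescent_of_dvd (W := WK _) rfl
    (nine_mul_cK_ne_zero (tpow_ne_zero 2 b)) two_ne_zero ?_ P
  rw [nine_mul_cK, log_val2_2t]; norm_num

/-- **`5 ∣ t`, `25 ∤ t` or `25 ∣ t` (`1 ≤ b ≤ 2`) ⟹ `i = 0`**: `χ₅(δ) = 0` by the level-one residue
character argument at `5` (window `[−b, −b]` contains no multiple of `3`), and `χ₅` of the normal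
form is `2i`. [cite: SilvermanAEC2009, Exercise 10.9] -/
theorem i_eq_zero_of_five (hi : i < 3) (hb1 : 1 ≤ b) (hb2 : b ≤ 2) : i = 0 := by
  have h0 : chi5 (delta (2 ^ a * 5 ^ b) P) = 0 := by
    refine isResidueChar_chi5.apply_cubicDescent_eq_zero (W := WK _) rfl
      (nine_mul_cK_ne_zero (tpow_ne_zero a b)) two_ne_zero ?_ ?_ ?_ P
    · rw [nine_mul_cK]; exact chi_natCast _ cubicChar_ratCast_five _
    · rw [nine_mul_cK, show (2 : K3) * ((2 ^ a * 5 ^ b : ℕ) : K3) = ((2 * (2 ^ a * 5 ^ b) : ℕ) : K3) by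
        push_cast; ring]
      exact chi_natCast _ cubicChar_ratCast_five _
    · intro n h1 h2 h3
      rw [nine_mul_cK, log_val5_2t] at h1
      rw [nine_mul_cK, log_val5_t] at h2
      exfalso; omega
  rw [hd, chi5_normalForm hs i k l hw] at h0
  have h0' : (i : ZMod 3) = 0 := by
    have h3 : ∀ x : ZMod 3, 2 * x = 0 → x = 0 := by decide
    exact h3 _ h0
  exact eq_zero_of_cast_zmod_three hi h0'

/-- **`t ≡ 5 (mod 9)` ⟹ `2k + l ≡ 0 (mod 3)`**: `μ(δ) = 0` by the level-three digit character
argument at `λ` (`2t ≡ 1 (mod 9)`, finite check `mu_eq_zero_of_units`), and `μ` of the normal form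
is `2k + l`. [cite: SilvermanAEC2009, Exercise 10.9] -/
theorem two_k_add_l (ht : (2 ^ a * 5 ^ b) % 9 = 5) : (2 * k + l : ZMod 3) = 0 := by
  have h2t : 2 * (2 ^ a * 5 ^ b) % 9 = 1 := by omega
  have h3t : ¬ 3 ∣ 2 ^ a * 5 ^ b := by omega
  have h0 : mu (delta (2 ^ a * 5 ^ b) P) = 0 := by
    refine isDigitChar_mu.apply_cubicDescent_eq_zero (W := WK _) rfl ?_ ?_ two_ne_zero ?_ ?_ P
    · rw [nine_mul_cK]; exact val_lam_natCast h3t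
    · rw [show (2 : K3) = ((2 : ℕ) : K3) by norm_num]; exact val_lam_natCast (by norm_num)
    · rw [nine_mul_cK, show (2 : K3) * ((2 ^ a * 5 ^ b : ℕ) : K3) = ((2 * (2 ^ a * 5 ^ b) : ℕ) : K3) by
        push_cast; ring, mu_natCast (by omega)]
      have h9 : ((2 * (2 ^ a * 5 ^ b) : ℕ) : ZMod 9) = 1 := by
        rw [← Nat.mod_add_div (2 * (2 ^ a * 5 ^ b)) 9, h2t]; push_cast
        rw [show (9 : ZMod 9) = 0 from rfl]; ring
      have h1 : ((2 * (2 ^ a * 5 ^ b) : ℕ) : R9) = 1 := by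
        ext
        · rw [QuadraticAlgebra.re_natCast, h9]; rfl
        · rw [QuadraticAlgebra.im_natCast]; rfl
      rw [h1]; exact muBar_values.1
    · intro β X hβ hβ2 hX hcube
      rw [nine_mul_cK] at hcube hβ2
      exact mu_eq_zero_of_units h2t hβ hX (by exact_mod_cast hcube)
  rw [hd, mu_normalForm hs i k l hw] at h0
  exact h0

end Conditions

/-! ### Counting -/

/-- **`#[δ(E_t(K3))] = 3^{rank E_t(ℚ) + 1}`** (the tree's `√−3`-descent count over `K3 = ℚ(√−3)`,
`θ = 2ζ + 1`, `σ` = complex conjugation). [cite: SilvermanAEC2009, X.4 Remark X.4.7] -/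
theorem natCard_range_deltaClass (a b : ℕ) :
    Nat.card (Set.range (deltaClass (2 ^ a * 5 ^ b))) =
      3 ^ ((mordellCurve (((2 ^ a * 5 ^ b : ℕ) : ℚ) ^ 2) : WeierstrassCurve ℚ).mordellWeilRank + 1) := by
  have ht : ((2 ^ a * 5 ^ b : ℕ) : ℚ) ≠ 0 := by exact_mod_cast tpow_ne_zero a b
  have hc : conjBar (algebraMap K3 _ (cK (2 ^ a * 5 ^ b))) = algebraMap K3 _ (cK (2 ^ a * 5 ^ b)) := by
    rw [cK, show ((2 ^ a * 5 ^ b : ℕ) : K3) / 9 = (((2 ^ a * 5 ^ b : ℕ) / 9 : ℚ) : K3) by push_cast; ring]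
    exact conjBar_ratCast _
  exact SqrtThree.natCard_range_cubicDescentClass_eq finrank_eq theta_sq conjBar conjBar_theta hc ht
    (by rw [map_natCast, nine_mul_cK])

/-- **Upper bound**: if `[δ(E_t(K3))] ⊆ g(ι)` with `#ι ≤ 3^s` then `rank E_t(ℚ) + 1 ≤ s`.
[cite: SilvermanAEC2009, X.4 Remark X.4.7] -/
theorem rank_add_one_le_of_range_subset (a b : ℕ) {ι : Type} [Fintype ι] (g : ι → CubeUnits K3)
    (h : Set.range (deltaClass (2 ^ a * 5 ^ b)) ⊆ Set.range g) {s : ℕ} (hι : Fintype.card ι ≤ 3 ^ s) :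
    (mordellCurve (((2 ^ a * 5 ^ b : ℕ) : ℚ) ^ 2) : WeierstrassCurve ℚ).mordellWeilRank + 1 ≤ s := by
  have h1 : Nat.card (Set.range (deltaClass (2 ^ a * 5 ^ b))) ≤ 3 ^ s :=
    calc Nat.card (Set.range (deltaClass (2 ^ a * 5 ^ b)))
        ≤ Nat.card (Set.range g) := Nat.card_mono (Set.finite_range g) h
      _ ≤ Nat.card ι := Finite.card_range_le g
      _ = Fintype.card ι := Nat.card_eq_fintype_card
      _ ≤ 3 ^ s := hι
  rw [natCard_range_deltaClass] at h1
  exact (Nat.pow_le_pow_iff_right (by norm_num)).mp h1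

/-- **Lower bound**: four distinct classes in `[δ(E_t(K3))]` give `1 ≤ rank E_t(ℚ)`
(`3^{0+1} = 3 < 4`). [cite: SilvermanAEC2009, X.4 Remark X.4.7] -/
theorem one_le_rank_of_four (a b : ℕ) (x : Fin 4 → CubeUnits K3) (hx : Function.Injective x)
    (hmem : ∀ n, x n ∈ Set.range (deltaClass (2 ^ a * 5 ^ b))) :
    1 ≤ (mordellCurve (((2 ^ a * 5 ^ b : ℕ) : ℚ) ^ 2) : WeierstrassCurve ℚ).mordellWeilRank := by
  have hcard := natCard_range_deltaClass a b
  have hfin : Finite (Set.range (deltaClass (2 ^ a * 5 ^ b))) := by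
    apply Nat.finite_of_card_ne_zero; rw [hcard]; positivity
  have h4 : 4 ≤ Nat.card (Set.range (deltaClass (2 ^ a * 5 ^ b))) := by
    have := Nat.card_le_card_of_injective (fun n : Fin 4 ↦ (⟨x n, hmem n⟩ : Set.range _))
      (fun m n h ↦ hx (by simpa using h))
    rwa [Nat.card_fin] at this
  rw [hcard] at h4
  by_contra h0
  rw [not_le, Nat.lt_one_iff] at h0
  rw [h0] at h4
  norm_num at h4

/-- **Lower bound, element form**: four pairwise distinct classes in `[δ(E_t(K3))]` give
`1 ≤ rank E_t(ℚ)`. [cite: SilvermanAEC2009, X.4 Remark X.4.7] -/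
theorem one_le_rank_of_four' (a b : ℕ) {x₀ x₁ x₂ x₃ : CubeUnits K3} (h01 : x₀ ≠ x₁) (h02 : x₀ ≠ x₂)
    (h03 : x₀ ≠ x₃) (h12 : x₁ ≠ x₂) (h13 : x₁ ≠ x₃) (h23 : x₂ ≠ x₃)
    (hm₀ : x₀ ∈ Set.range (deltaClass (2 ^ a * 5 ^ b))) (hm₁ : x₁ ∈ Set.range (deltaClass (2 ^ a * 5 ^ b)))
    (hm₂ : x₂ ∈ Set.range (deltaClass (2 ^ a * 5 ^ b))) (hm₃ : x₃ ∈ Set.range (deltaClass (2 ^ a * 5 ^ b))) :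
    1 ≤ (mordellCurve (((2 ^ a * 5 ^ b : ℕ) : ℚ) ^ 2) : WeierstrassCurve ℚ).mordellWeilRank := by
  refine one_le_rank_of_four a b ![x₀, x₁, x₂, x₃] ?_ ?_
  · intro m n h
    fin_cases m <;> fin_cases n
    all_goals first
      | rfl
      | (exfalso; simp at h
         first
         | exact h01 h | exact h02 h | exact h03 h | exact h12 h | exact h13 h | exact h23 h
         | exact h01 h.symm | exact h02 h.symm | exact h03 h.symm | exact h12 h.symm
         | exact h13 h.symm | exact h23 h.symm)
  · intro n
    fin_cases n
    · exact hm₀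
    · exact hm₁
    · exact hm₂
    · exact hm₃

/-! ### Classes of explicit points -/

/-- The curve equation over `K3` from an integral solution of `Y² = X³ + t²`. [folklore] -/
theorem eqn_cast {t : ℕ} {X Y : ℤ} (h : Y ^ 2 = X ^ 3 + (t : ℤ) ^ 2) :
    (Y : K3) ^ 2 = (X : K3) ^ 3 + (9 * cK t) ^ 2 := by
  rw [nine_mul_cK]
  have := congrArg (Int.cast : ℤ → K3) h
  simpa only [Int.cast_pow, Int.cast_add, Int.cast_natCast] using this

/-- `((n : ℤ) : K3) = ((m : ℤ) : K3) → n = m` (via the `re`-coordinate). [folklore] -/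
theorem intCast_injective_K3 {n m : ℤ} (h : (n : K3) = (m : K3)) : n = m := by
  have := congrArg QuadraticAlgebra.re h
  rw [QuadraticAlgebra.re_intCast, QuadraticAlgebra.re_intCast] at this
  exact_mod_cast this

/-- An integral point `(X, Y)`, `Y² = X³ + t²`, of `E_t(K3)`. [folklore] -/
def pt (t : ℕ) (ht : t ≠ 0) (X Y : ℤ) (h : Y ^ 2 = X ^ 3 + (t : ℤ) ^ 2) : (WK t).toAffine.Point :=
  haveI : (WK t).IsElliptic := isElliptic_mordellCurve (pow_ne_zero 2 (nine_mul_cK_ne_zero ht))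
  .some (X : K3) (Y : K3) ((Affine.equation_iff_nonsingular (W := WK t)).mp
    ((equation_iff_of_eq (W := WK t) rfl _ _).mpr (eqn_cast h)))

/-- `[δ(X, Y)] = [Y + t]` for `Y ≠ −t`. [cite: Cassels1964ArithmeticVI, p. 65] -/
theorem deltaClass_pt (t : ℕ) (ht : t ≠ 0) (X Y : ℤ) (h : Y ^ 2 = X ^ 3 + (t : ℤ) ^ 2)
    (hY : Y ≠ -t) : deltaClass t (pt t ht X Y h) = cubeClass (((Y + t : ℤ) : ℚ) : K3) := by
  have hne : (Y : K3) ≠ -(9 * cK t) := by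
    rw [nine_mul_cK, ← Int.cast_natCast, ← Int.cast_neg]
    exact fun h' ↦ hY (intCast_injective_K3 h')
  rw [deltaClass, pt, cubicDescentClass, cubicDescent_some_of_ne _ _ hne, nine_mul_cK,
    Rat.cast_intCast, Int.cast_add, Int.cast_natCast]

/-- `[δ(0, −t)] = [(2t)²]`. [cite: Cassels1964ArithmeticVI, p. 65] -/
theorem deltaClass_negT (t : ℕ) (ht : t ≠ 0) :
    deltaClass t (pt t ht 0 (-t) (by ring)) = cubeClass ((((2 * t) ^ 2 : ℕ) : ℚ) : K3) := by
  have heq : ((-t : ℤ) : K3) = -(9 * cK t) := by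
    rw [nine_mul_cK, Int.cast_neg, Int.cast_natCast]
  rw [deltaClass, pt, cubicDescentClass, cubicDescent_some_of_eq _ _ heq, nine_mul_cK,
    Rat.cast_natCast, Nat.cast_pow, Nat.cast_mul, Nat.cast_ofNat]

/-- `1 = [δ(O)] ∈ [δ(E_t(K3))]`. [folklore] -/
theorem one_mem_range (t : ℕ) : (1 : CubeUnits K3) ∈ Set.range (deltaClass t) :=
  ⟨0, cubicDescentClass_zero _⟩

/-! ### `p`-adic valuations of explicit rationals -/

/-- `ord_p (p^e m / n) = e` for `p ∤ m n`. [folklore] -/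
theorem padicValRat_prime_pow_mul_div {p : ℕ} [hp : Fact p.Prime] (e : ℕ) {m n : ℕ} (hm : ¬ p ∣ m)
    (hn : ¬ p ∣ n) : padicValRat p ((p : ℚ) ^ e * m / n) = e := by
  have hm0 : m ≠ 0 := fun h ↦ hm (h ▸ dvd_zero p)
  have hn0 : n ≠ 0 := fun h ↦ hn (h ▸ dvd_zero p)
  have hp0 : (p : ℚ) ≠ 0 := by exact_mod_cast hp.out.ne_zero
  rw [padicValRat.div (mul_ne_zero (pow_ne_zero _ hp0) (by exact_mod_cast hm0)) (by exact_mod_cast hn0),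
    padicValRat.mul (pow_ne_zero _ hp0) (by exact_mod_cast hm0), padicValRat.pow, padicValRat.self hp.out.one_lt,
    show (m : ℚ) = ((m : ℕ) : ℚ) from rfl, padicValRat.of_nat, show (n : ℚ) = ((n : ℕ) : ℚ) from rfl,
    padicValRat.of_nat, padicValNat.eq_zero_of_not_dvd hm, padicValNat.eq_zero_of_not_dvd hn]
  simp

/-- `ord_p (m / (p^e n)) = −e` for `p ∤ m n`. [folklore] -/
theorem padicValRat_div_prime_pow_mul {p : ℕ} [hp : Fact p.Prime] (e : ℕ) {m n : ℕ} (hm : ¬ p ∣ m)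
    (hn : ¬ p ∣ n) : padicValRat p ((m : ℚ) / ((p : ℚ) ^ e * n)) = -e := by
  have h := padicValRat_prime_pow_mul_div (p := p) e hn hm
  have hm0 : m ≠ 0 := fun h ↦ hm (h ▸ dvd_zero p)
  have hn0 : n ≠ 0 := fun h ↦ hn (h ▸ dvd_zero p)
  have hp0 : (p : ℚ) ≠ 0 := by exact_mod_cast hp.out.ne_zero
  rw [show (m : ℚ) / ((p : ℚ) ^ e * n) = ((p : ℚ) ^ e * n / m)⁻¹ by rw [inv_div], padicValRat.inv, h]

end CubicTwist

end Literature.Barriers.BirchSwinnertonDyer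

end
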